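import Summits.ResolutionOfSingularities.ResolutionOfSingularities.Theorems.HilbertSamuelEliminationSigmaMaxModificationsCorridor3WLadderIsoProximityDefs
import HarnessLib

/-!
# [OURS · L1 W4.2] MODULE `Corridor3WLadderIsoProximity` (crux chain w42, idea-1 ROUND 6 Sketch C5) — part 2/2: the PROVED glue

See part 1/2 `…Corridor3WLadderIsoProximityDefs`.  This part lands the seven PROVED theorems of the sketch BYTE-IDENTICAL:
`isoQuadraticTowerTerminates_of_trichotomy` (K1 + K2 + K3 ⇒ the isolated kernel `IsoQuadraticTowerTerminates p N`),
`isoQuadraticTowerTerminates_of_recurrent`, `isoSepJumpRecurrentImpossible_of`, `isoSepSatelliteRecurrentImpossible_of`,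
`isoQuadraticTowerTerminates_of_four` (K1 + (k2) `IsoInsepTowerTerminates` + separable-restricted K2/K3 ⇒ kernel), `isoQuadraticTowerTerminates_of_three`.
Pure logic over the rows (every chain has finitely or infinitely many jumps / satellite / inseparable stages); the rows themselves are OPEN
(K1 = DEAL D14, res-L1-w42-lead-1; K2/K3 = ideation r7).  OURS; NOT statements of print or of the manuscript; AI typing, weaker than expert review.
-/

noncomputable section

-- cell module setting (namespace `Summit.ResolutionOfSingularities.ResolutionOfSingularities.…` re-enters the summit name)
set_option linter.dupNamespace false

open CategoryTheory AlgebraicGeometry TopologicalSpace IsLocalRing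
open Summit.ResolutionOfSingularities.ResolutionOfSingularities.Theorems.CampaignW42
open Summit.ResolutionOfSingularities.ResolutionOfSingularities.Theorems.SigmaMaxModificationsCorridor3.Moving
open Literature.AlgebraicGeometry.Resolution Literature.AlgebraicGeometry.CossartJannsenSaito2020
open Summit.ResolutionOfSingularities.ResolutionOfSingularities.Cruxes.SigmaMaxModifications.IdeasL1Idea2R4
  (IsIsoPointTower IsoQuadraticTowerTerminates)

namespace Summit.ResolutionOfSingularities.ResolutionOfSingularities.Cruxes.SigmaMaxModifications.IdeasL1C5

universe u

/-! ## §2. The PROVED glue of the proximity trichotomy -/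

/-- **THE TRICHOTOMY GLUE (PROVED)**: arc lemma `K1` + jump-recurrence `K2` + satellite-recurrence `K3` ⇒ the isolated kernel
`IsoQuadraticTowerTerminates p N` of the W-top rows (p500943).  Pure logic: a tower with finitely many jumps and finitely many
satellite steps has a free-rational tail. [folklore] -/
theorem isoQuadraticTowerTerminates_of_trichotomy {p N : ℕ} (h1 : IsoFreeRationalTailsImpossible.{u} p N)
    (h2 : IsoJumpRecurrentImpossible.{u} p N) (h3 : IsoSatelliteRecurrentImpossible.{u} p N) :
    IsoQuadraticTowerTerminates.{u} p N := by
  intro ν T pt hO hT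
  have hJ := h2 ν T pt hO hT
  have hS := h3 ν T pt hO hT
  push Not at hJ hS
  obtain ⟨n₁, hn₁⟩ := hJ
  obtain ⟨n₂, hn₂⟩ := hS
  exact h1 ν T pt hO hT ⟨max n₁ n₂, fun n hn =>
    ⟨hn₁ n (le_trans (le_max_left _ _) hn), hn₂ n (le_trans (le_max_right _ _) hn)⟩⟩

/-- The two recurrent classes are where the translation-recurrent residual T3 of card C4 now lives: a free-rational tail is
in particular «fully translated» at every step, so **K1 removes from T3 exactly the towers everyone feared first** (generic
kangaroo-style translations for ever), provably.  Recorded as the specialisation of the glue with K1 discharged last. [folklore] -/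
theorem isoQuadraticTowerTerminates_of_recurrent {p N : ℕ} (h2 : IsoJumpRecurrentImpossible.{u} p N)
    (h3 : IsoSatelliteRecurrentImpossible.{u} p N) (h1 : IsoFreeRationalTailsImpossible.{u} p N) :
    IsoQuadraticTowerTerminates.{u} p N :=
  isoQuadraticTowerTerminates_of_trichotomy h1 h2 h3

/-! ## §3. The kernel's three- and four-way cover (PROVED joins) -/

/-- The unrestricted row K2 of §2 implies the separable-restricted one (compatibility with the trichotomy). [folklore] -/
theorem isoSepJumpRecurrentImpossible_of {p N : ℕ} (h : IsoJumpRecurrentImpossible.{u} p N) :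
    IsoSepJumpRecurrentImpossible.{u} p N :=
  fun ν T pt hO hT _ => h ν T pt hO hT

/-- The unrestricted row K3 of §2 implies the separable-restricted one (compatibility with the trichotomy). [folklore] -/
theorem isoSepSatelliteRecurrentImpossible_of {p N : ℕ} (h : IsoSatelliteRecurrentImpossible.{u} p N) :
    IsoSepSatelliteRecurrentImpossible.{u} p N :=
  fun ν T pt hO hT _ => h ν T pt hO hT

/-- **THE FOUR-WAY KERNEL JOIN (PROVED)** — RULINGS v3.12-1 (F) made intrinsic: arc lemma K1 (free-rational tails, provable now) +
(k2) `IsoInsepTowerTerminates` + jumps / satellites on eventually-separable towers ⇒ `IsoQuadraticTowerTerminates p N`. [folklore] -/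
theorem isoQuadraticTowerTerminates_of_four {p N : ℕ} (h1 : IsoFreeRationalTailsImpossible.{u} p N)
    (hI : IsoInsepTowerTerminates.{u} p N) (h2 : IsoSepJumpRecurrentImpossible.{u} p N)
    (h3 : IsoSepSatelliteRecurrentImpossible.{u} p N) : IsoQuadraticTowerTerminates.{u} p N := by
  intro ν T pt hO hT
  have hsep : ∃ n₀, ∀ n, n₀ ≤ n → ¬ IsInsepStage T pt n := by
    have h := hI ν T pt hO hT
    push Not at h
    obtain ⟨n₀, hn₀⟩ := h
    exact ⟨n₀, fun n hn => hn₀ n hn⟩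
  have hJ := h2 ν T pt hO hT hsep
  have hS := h3 ν T pt hO hT hsep
  push Not at hJ hS
  obtain ⟨n₁, hn₁⟩ := hJ
  obtain ⟨n₂, hn₂⟩ := hS
  exact h1 ν T pt hO hT ⟨max n₁ n₂, fun n hn =>
    ⟨hn₁ n (le_trans (le_max_left _ _) hn), hn₂ n (le_trans (le_max_right _ _) hn)⟩⟩

/-- … and the three-way form with plan-1's names: (k2) insep + the §2 rows K2/K3 (separable-restricted, paired) + K1. [folklore] -/
theorem isoQuadraticTowerTerminates_of_three {p N : ℕ} (h1 : IsoFreeRationalTailsImpossible.{u} p N)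
    (hI : IsoInsepTowerTerminates.{u} p N)
    (h23 : IsoSepJumpRecurrentImpossible.{u} p N ∧ IsoSepSatelliteRecurrentImpossible.{u} p N) :
    IsoQuadraticTowerTerminates.{u} p N :=
  isoQuadraticTowerTerminates_of_four h1 hI h23.1 h23.2

end Summit.ResolutionOfSingularities.ResolutionOfSingularities.Cruxes.SigmaMaxModifications.IdeasL1C5

end
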